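import Summits.BirchSwinnertonDyer.BirchSwinnertonDyer.Theorems.ManinLocalTwoThreeGenerationDegeneracyImage
import HarnessLib

/-!
# Route `ManinLocalTwoThree`, cruxes C2 (stmt-BirchSwinnertonDyer-22967) / C3 (stmt-BirchSwinnertonDyer-22968): the
# DICTIONARY from an Ihara-type cokernel statement (in the elementwise Hecke currency of the tree's
# `ribet1984_iharaLemma`: «some `s` in the Hecke ring carries `H₁(X₀(N), ℤ)` into the image of the degeneracy
# push-forwards») to the oldform-lattice containments `m·Λ_f ⊆ Λ_h` equivalent to E-es-19 / E-es-22
# (line prover p3; helper, unconditional)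

If `s ∈ 𝕋_ℤ` acts on the newform `f` as multiplication by an INTEGER `m` and every cycle `s·x`, `x ∈ H₁(X₀(N), ℤ)`, is
(after pairing with the oldform `g`) a period of `g` over `H₁(X₀(L), ℤ)`, then `m·Λ_f ⊆ Λ_g`
(`periodLattice_mul_subset_of_hecke_cokernel`; `(s·x)(f) = x(s f) = m·x(f)`, `HeckeRing0.smul_dual_apply`).  With
`g = f∣ι₃ − f∣ι₁` on `Γ₀(3N)` (`shiftClassGenerationThree_of_hecke_cokernel`) resp. `g = Σ_T (−1)^{|T|} f∣ι_{∏T}` on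
`Γ₀(8N²)` (`multiShiftClassGenerationTwo_of_hecke_cokernel`) and `p ∤ m`, this is exactly the input shape of
`shiftClassGenerationThree_iff_degeneracyImage` / `multiShiftClassGenerationTwo_iff_degeneracyImage`: once the cell's
relative Ihara statement at `p ∣ N` (MEMO-es §21, E-es-25) is typed like `ribet1984_iharaLemma` — `∃ s ∉ 𝔫_f` with
`s·H₁(X₀(N), ℤ) ⊆ im(Σ ± ι_e^∨)` — and `s ∉ 𝔫_f` is read as «`s f = m f` with `p ∤ m`», E-es-19 / E-es-22 follow BY NAME.
Nothing about BSD, Manin's conjecture, E-es-19, E-es-22 or E-es-25 is proved here.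
-/

set_option autoImplicit false
set_option linter.dupNamespace false

noncomputable section

open scoped Classical MatrixGroups ModularForm BigOperators

open CongruenceSubgroup Matrix.SpecialLinearGroup ModularGroup
  Literature.NumberTheory.EllipticCurves Literature.NumberTheory.EllipticCurves.ModularForms
  Summit.BirchSwinnertonDyer.Rank1Residual.ManinAdditive

namespace Summit.BirchSwinnertonDyer.BirchSwinnertonDyer.Theorems.ManinLocalTwoThree

/-- **Dictionary: Hecke cokernel statement ⟹ lattice containment.** Let `f ∈ S₂(Γ₀(N))`, `g ∈ S₂(Γ₀(L))`, and let
`s ∈ 𝕋_ℤ` (level `N`) act on `f` as the integer `m` (`s f = m f`). If for every cycle `x ∈ H₁(X₀(N), ℤ)` the number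
`(s·x)(f)` is a period `z(g)` of `g` over some `z ∈ H₁(X₀(L), ℤ)`, then `m·Λ_f ⊆ Λ_g`. [folklore] -/
theorem periodLattice_mul_subset_of_hecke_cokernel {N L : ℕ} [NeZero N] [NeZero L] (f : CuspForm (Gamma0 N) 2)
    (g : CuspForm (Gamma0 L) 2) (s : HeckeRing0 N 2) (m : ℤ) (hs : HeckeRing0.toEnd N 2 s f = (m : ℂ) • f)
    (hsur : ∀ x ∈ periodHomology N, ∃ z ∈ periodHomology L, z g = (s • x) f) :
    ∀ w ∈ periodLattice f, (m : ℂ) * w ∈ periodLattice g := by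
  intro w hw
  obtain ⟨x, hx, rfl⟩ := (mem_periodLattice_iff_exists_periodHomology f w).mp hw
  obtain ⟨z, hz, hzg⟩ := hsur x hx
  refine (mem_periodLattice_iff_exists_periodHomology g _).mpr ⟨z, hz, ?_⟩
  rw [hzg, HeckeRing0.smul_dual_apply, hs, map_smul, smul_eq_mul]

/-- **E-es-19 from a Hecke cokernel statement for `β_* − α_*` at `3 ∣ N`.** If for every `W`-newform `f` (`9 ∣ N`,
`W[3]` irreducible) there are `s ∈ 𝕋_ℤ` and `m ∈ ℤ` with `3 ∤ m`, `s f = m f`, and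
`s·H₁(X₀(N), ℤ) ⊆ (ι₃^∨ − ι₁^∨) H₁(X₀(3N), ℤ)` elementwise, then `ShiftClassGenerationThree`. [folklore] -/
theorem shiftClassGenerationThree_of_hecke_cokernel
    (H : ∀ (W : WeierstrassCurve ℚ) [W.IsElliptic] {N : ℕ} [NeZero N] (f : CuspForm (Gamma0 N) 2),
      IsNewformOf W f → 3 ^ 2 ∣ N → W.HasIrreducibleModPGaloisRep 3 →
      ∃ (s : HeckeRing0 N 2) (m : ℤ), ¬ (3 : ℤ) ∣ m ∧ HeckeRing0.toEnd N 2 s f = (m : ℂ) • f ∧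
        ∀ x ∈ periodHomology N, ∃ z ∈ periodHomology (3 * N),
          (degeneracyMap0 N (3 * N) 3 2).dualMap z - (degeneracyMap0 N (3 * N) 1 2).dualMap z = s • x) :
    ShiftClassGenerationThree := by
  rw [shiftClassGenerationThree_iff_oldformLattice]
  intro W _ N _ f hf h9 hirr
  obtain ⟨s, m, hm, hs, hsur⟩ := H W f hf h9 hirr
  obtain ⟨k, hk⟩ := Int.eq_nat_or_neg m
  refine ⟨k, fun h => hm ?_, fun w hw => ?_⟩
  · rcases hk with rfl | rfl
    · exact Int.natCast_dvd_natCast.mpr h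
    · exact (Int.natCast_dvd_natCast.mpr h).neg_right
  have key := periodLattice_mul_subset_of_hecke_cokernel f
    (degeneracyMap0 N (3 * N) 3 2 f - degeneracyMap0 N (3 * N) 1 2 f) s m hs (fun x hx => ?_) w hw
  · rcases hk with rfl | rfl
    · push_cast at key
      exact key
    · push_cast at key
      rw [neg_mul] at key
      exact neg_mem_iff.mp key
  · obtain ⟨z, hz, hzs⟩ := hsur x hx
    refine ⟨z, hz, ?_⟩
    rw [← hzs, LinearMap.sub_apply, map_sub, LinearMap.dualMap_apply, LinearMap.dualMap_apply]

/-- **E-es-22 from a Hecke cokernel statement for `Σ_T (−1)^{|T|} (ι_{∏T})_*` at the primes of `Gen(N)`.** If for every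
`W`-newform `f` (`4 ∣ N`, `W[2]` irreducible) there are `s ∈ 𝕋_ℤ` and an ODD `m ∈ ℤ` with `s f = m f` and
`s·H₁(X₀(N), ℤ) ⊆ (Σ_T (−1)^{|T|} ι_{∏T}^∨) H₁(X₀(8N²), ℤ)` elementwise, then `MultiShiftClassGenerationTwo`. [folklore] -/
theorem multiShiftClassGenerationTwo_of_hecke_cokernel
    (H : ∀ (W : WeierstrassCurve ℚ) [W.IsElliptic] {N : ℕ} [NeZero N] (f : CuspForm (Gamma0 N) 2),
      IsNewformOf W f → 2 ^ 2 ∣ N → W.HasIrreducibleModPGaloisRep 2 →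
      ∃ (s : HeckeRing0 N 2) (m : ℤ), ¬ (2 : ℤ) ∣ m ∧ HeckeRing0.toEnd N 2 s f = (m : ℂ) • f ∧
        ∀ x ∈ periodHomology N, ∃ z ∈ periodHomology (8 * N ^ 2),
          (∑ T ∈ (insert 8 (N.primeFactors.filter fun q => ¬ q ^ 2 ∣ N)).powerset,
            (-1 : ℂ) ^ T.card • (degeneracyMap0 N (8 * N ^ 2) (∏ t ∈ T, t - 1 + 1) 2).dualMap z) = s • x) :
    MultiShiftClassGenerationTwo := by
  rw [multiShiftClassGenerationTwo_iff_oldformLattice]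
  intro W _ N _ f hf h4 hirr
  obtain ⟨s, m, hm, hs, hsur⟩ := H W f hf h4 hirr
  obtain ⟨k, hk⟩ := Int.eq_nat_or_neg m
  refine ⟨k, fun h => hm ?_, fun w hw => ?_⟩
  · rcases hk with rfl | rfl
    · exact Int.natCast_dvd_natCast.mpr h
    · exact (Int.natCast_dvd_natCast.mpr h).neg_right
  have key := periodLattice_mul_subset_of_hecke_cokernel f
    (∑ T ∈ (insert 8 (N.primeFactors.filter fun q => ¬ q ^ 2 ∣ N)).powerset,
      (-1 : ℂ) ^ T.card • degeneracyMap0 N (8 * N ^ 2) (∏ t ∈ T, t - 1 + 1) 2 f) s m hs (fun x hx => ?_) w hw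
  · rcases hk with rfl | rfl
    · push_cast at key
      exact key
    · push_cast at key
      rw [neg_mul] at key
      exact neg_mem_iff.mp key
  · obtain ⟨z, hz, hzs⟩ := hsur x hx
    refine ⟨z, hz, ?_⟩
    rw [← hzs, map_sum, LinearMap.sum_apply]
    refine Finset.sum_congr rfl fun T _ => ?_
    rw [map_smul, LinearMap.smul_apply, LinearMap.dualMap_apply]

end Summit.BirchSwinnertonDyer.BirchSwinnertonDyer.Theorems.ManinLocalTwoThree

end
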